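import Mathlib
import Literature.AlgebraicGeometry.Resolution.AdicQuotient
import Literature.AlgebraicGeometry.Resolution.CompletionBaseChange
import Literature.AlgebraicGeometry.Resolution.FiniteOverCompleteLocal
import Literature.AlgebraicGeometry.Resolution.CompleteLocalDomainNormalization
import Literature.RingTheory.KrullDimension.AffineDimension
import Summits.Langlands.Langlands.Theorems.SkinnerWilesDefectOneReducibleOrdinaryProModularReflexiveHullLocal
import HarnessLib

/-!
# `TeissierResolve`, line Sketch — lemmas for the stub `stub_toricNormalisation_dimLeOne`
# (complete discrete valuation rings with algebraically closed coefficient field)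

Crux `stmt-ResolutionOfSingularities-17086`
(`Summit.ResolutionOfSingularities.ResolutionOfSingularities.Theses.TeissierJung.TeissierResolve`),
line "toric normalisation + destackification". Generic commutative algebra used by the `d ≤ 1`
slice of toric normalisation (`…ToricNormalisationDimLeOne.lean`): over an algebraically closed
field `k`, the normalisation `N` of a domain `B` module-finite over `k⟦t⟧` or over `k` is `k` or
a complete discrete valuation ring with residue field `k`, and the latter is the `(X)`-adic
completion of `k[X]`.

## Contents (all PROVED, no named facts)

* `isIntegral_comp_of_forall_sub_mem`, `comp_bijective_of_forall_sub_mem` — if `g : A → C` is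
  integral and kills an ideal `I` with `A = ι(k) + I`, then `g ∘ ι : k → C` is integral, hence
  bijective for `k` algebraically closed and `C` a domain.
* `quotientMap_eval₂RingHom_bijective`, `nonempty_equiv_adicCompletion_polynomial` — for a
  domain `N`, a non-unit `s ≠ 0` and `ι : k → N` (`k` a field) with `N = ι(k) + sN`, the level
  maps `k[X]/(Xⁿ) → N/(sⁿ)`, `X ↦ s`, are bijective, whence `N ≅ N^_{(s)} ≅ k[X]^_{(X)}` if `N`
  is `(s)`-adically complete (tree `adicCompletionEquivOfQuotientMap`; Serre, *Local Fields*
  II §4: equicharacteristic complete discrete valuation rings with a coefficient field).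
* `nonempty_integralClosure_equiv_of_le_ker` — a domain `B` integral over `A` with `A → B`
  killing an ideal `I`, `A = ι(k) + I`, `k` algebraically closed, has normalisation `≅ k`.
* `exists_uniformizer_integralClosure` — for `A` a complete one-dimensional Noetherian local
  domain with `A = ι(k) + 𝔪_A` and `B ⊇ A` a module-finite domain, the normalisation `N` of `B`
  (a complete DVR: tree `isDiscreteValuationRing_integralClosure_of_complete`, and a local ring
  finite over a complete local ring is complete, `isAdicComplete_maximalIdeal_of_finite` of
  `Summits/Langlands/…/SkinnerWilesDefectOneReducibleOrdinaryProModularReflexiveHullLocal.lean`)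
  has a uniformiser `s` with `N = ι(k) + sN` and is `(s)`-adically complete.
* `exists_sub_C_mem_maximalIdeal` — `k⟦X_σ⟧ = C(k) + 𝔪`.

Sources: Matsumura, *Commutative Ring Theory* (1986), Thm. 8.7, 8.15; Serre, *Local Fields*,
II §4; Kiyek–Vicente (2004), Ch. II (3.17). The statements here are folklore. [folklore]
-/

noncomputable section

set_option linter.dupNamespace false -- mandated namespace of this single-conjunct summit

open IsLocalRing Polynomial
open Literature.AlgebraicGeometry.Resolution

namespace Summit.ResolutionOfSingularities.ResolutionOfSingularities.Theorems.TeissierResolve.ToricNormalisationDimLeOneLemmas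

universe u v w

/-! ## Integrality over a coefficient field -/

section CoefficientField

variable {k : Type u} {A : Type v} {C : Type w} [CommRing k] [CommRing A] [CommRing C]

/-- If `g : A → C` is integral and kills an ideal `I` such that every element of `A` is congruent
modulo `I` to an element of `ι(k)`, then `g ∘ ι : k → C` is integral (`g` factors through
`A / I`, onto which `k` maps surjectively). [folklore] -/
theorem isIntegral_comp_of_forall_sub_mem (ι : k →+* A) (I : Ideal A)
    (hI : ∀ a : A, ∃ c : k, a - ι c ∈ I) (g : A →+* C) (hg : g.IsIntegral)
    (hIg : I ≤ RingHom.ker g) : (g.comp ι).IsIntegral := by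
  have hsurj : Function.Surjective ((Ideal.Quotient.mk I).comp ι) := fun z => by
    obtain ⟨a, rfl⟩ := Ideal.Quotient.mk_surjective z
    obtain ⟨c, hc⟩ := hI a
    refine ⟨c, ?_⟩
    rw [RingHom.comp_apply, Ideal.Quotient.mk_eq_mk_iff_sub_mem, ← Ideal.neg_mem_iff, neg_sub]
    exact hc
  have h1 : (Ideal.Quotient.lift I g fun a ha => hIg ha).IsIntegral :=
    RingHom.IsIntegral.tower_top (Ideal.Quotient.mk I) _ (by rwa [Ideal.Quotient.lift_comp_mk])
  have h2 := RingHom.IsIntegral.trans _ _ (RingHom.isIntegral_of_surjective _ hsurj) h1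
  rwa [← RingHom.comp_assoc, Ideal.Quotient.lift_comp_mk] at h2

/-- With `k` algebraically closed and `C` a domain, `g ∘ ι` as in
`isIntegral_comp_of_forall_sub_mem` is bijective. [folklore] -/
theorem comp_bijective_of_forall_sub_mem {k : Type u} [Field k] [IsAlgClosed k] [IsDomain C]
    (ι : k →+* A) (I : Ideal A) (hI : ∀ a : A, ∃ c : k, a - ι c ∈ I) (g : A →+* C)
    (hg : g.IsIntegral) (hIg : I ≤ RingHom.ker g) : Function.Bijective (g.comp ι) :=
  IsAlgClosed.ringHom_bijective_of_isIntegral _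
    (isIntegral_comp_of_forall_sub_mem ι I hI g hg hIg)

end CoefficientField

/-! ## `k[X]^_{(X)} ≅ N^_{(s)}` for `N = ι(k) + sN` -/

section PolynomialModel

variable {k : Type u} [Field k] {N : Type u} [CommRing N]

/-- `X ↦ s` maps `(X)` into `(s)`. [folklore] -/
theorem map_span_X_le (ι : k →+* N) (s : N) :
    (Ideal.span {(X : k[X])}).map (eval₂RingHom ι s) ≤ Ideal.span {s} := by
  rw [Ideal.map_span, Set.image_singleton, coe_eval₂RingHom, eval₂_X]

/-- If `N = ι(k) + sN` then every element of `N` is a polynomial in `s` with coefficients in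
`ι(k)` modulo `sⁿ`. [folklore] -/
theorem exists_sub_eval₂_mem_pow (ι : k →+* N) (s : N)
    (hres : ∀ x : N, ∃ c : k, x - ι c ∈ Ideal.span {s}) (n : ℕ) (x : N) :
    ∃ q : k[X], x - eval₂RingHom ι s q ∈ Ideal.span {s} ^ n := by
  induction n generalizing x with
  | zero => exact ⟨0, by rw [pow_zero, Ideal.one_eq_top]; exact Submodule.mem_top⟩
  | succ n ih =>
    obtain ⟨c, hc⟩ := hres x
    obtain ⟨y, hy⟩ := Ideal.mem_span_singleton.mp hc
    obtain ⟨q, hq⟩ := ih y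
    refine ⟨C c + X * q, ?_⟩
    have : x - eval₂RingHom ι s (C c + X * q) = s * (y - eval₂RingHom ι s q) := by
      rw [map_add, map_mul, coe_eval₂RingHom, eval₂_C, eval₂_X, mul_sub, ← hy]
      ring
    rw [this, pow_succ']
    exact Ideal.mul_mem_mul (Ideal.mem_span_singleton_self s) hq

/-- If `s ≠ 0` is not a unit of the domain `N` and `q(s) ∈ (sⁿ)` for a polynomial `q` with
coefficients in the field `ι(k)`, then `Xⁿ ∣ q` (induction: the constant coefficient of
`q / X^m` is a unit or zero). [folklore] -/
theorem X_pow_dvd_of_eval₂_mem_pow [IsDomain N] (ι : k →+* N) (s : N) (hs0 : s ≠ 0)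
    (hsu : ¬IsUnit s) (n : ℕ) (q : k[X]) (hq : eval₂RingHom ι s q ∈ Ideal.span {s} ^ n) :
    X ^ n ∣ q := by
  induction n generalizing q with
  | zero => exact ⟨q, by rw [pow_zero, one_mul]⟩
  | succ n ih =>
    obtain ⟨r, rfl⟩ := ih q (Ideal.pow_le_pow_right n.le_succ hq)
    rw [Ideal.span_singleton_pow, Ideal.mem_span_singleton, map_mul, map_pow, coe_eval₂RingHom,
      eval₂_X, pow_succ] at hq
    obtain ⟨z, hz⟩ := hq
    rw [mul_assoc] at hz
    have hr : eval₂ ι s r = s * z := mul_left_cancel₀ (pow_ne_zero n hs0) hz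
    have key : ι (r.coeff 0) = s * (z - eval₂ ι s (divX r)) := by
      have h := congrArg (eval₂ ι s) (X_mul_divX_add r)
      rw [eval₂_add, eval₂_mul, eval₂_X, eval₂_C, hr] at h
      linear_combination h
    have h0 : r.coeff 0 = 0 := by
      by_contra h
      exact hsu (isUnit_of_mul_isUnit_left (key ▸ (isUnit_iff_ne_zero.mpr h).map ι))
    obtain ⟨r', rfl⟩ := X_dvd_iff.mpr h0
    exact ⟨r', by ring⟩

/-- **The level maps `k[X]/(Xⁿ) → N/(sⁿ)`, `X ↦ s`, are bijective** when `N` is a domain,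
`s ≠ 0` is not a unit and `N = ι(k) + sN`. [folklore] -/
theorem quotientMap_eval₂RingHom_bijective [IsDomain N] (ι : k →+* N) (s : N) (hs0 : s ≠ 0)
    (hsu : ¬IsUnit s) (hres : ∀ x : N, ∃ c : k, x - ι c ∈ Ideal.span {s}) (n : ℕ) :
    Function.Bijective (Ideal.quotientMap (Ideal.span {s} ^ n) (eval₂RingHom ι s)
      (pow_le_comap_pow_of_map_le (eval₂RingHom ι s) (map_span_X_le ι s) n)) := by
  constructor
  · rw [injective_iff_map_eq_zero]
    intro z hz
    obtain ⟨q, rfl⟩ := Ideal.Quotient.mk_surjective z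
    rw [Ideal.quotientMap_mk, Ideal.Quotient.eq_zero_iff_mem] at hz
    rw [Ideal.Quotient.eq_zero_iff_mem, Ideal.span_singleton_pow, Ideal.mem_span_singleton]
    exact X_pow_dvd_of_eval₂_mem_pow ι s hs0 hsu n q hz
  · intro z
    obtain ⟨x, rfl⟩ := Ideal.Quotient.mk_surjective z
    obtain ⟨q, hq⟩ := exists_sub_eval₂_mem_pow ι s hres n x
    refine ⟨Ideal.Quotient.mk _ q, ?_⟩
    rw [Ideal.quotientMap_mk, Ideal.Quotient.mk_eq_mk_iff_sub_mem, ← Ideal.neg_mem_iff, neg_sub]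
    exact hq

/-- **An `(s)`-adically complete domain `N` with `N = ι(k) + sN` (`s ≠ 0` a non-unit, `k` a
field) is isomorphic to `k[X]^_{(X)} = k⟦X⟧**: `N ≅ N^_{(s)} ≅ k[X]^_{(X)}`, the second map being
the limit of the bijective levels `k[X]/(Xⁿ) ≅ N/(sⁿ)` (tree `adicCompletionEquivOfQuotientMap`)
— the structure of equicharacteristic complete discrete valuation rings with a coefficient field
(Serre, *Local Fields* II §4). [folklore] -/
theorem nonempty_equiv_adicCompletion_polynomial [IsDomain N] (ι : k →+* N) (s : N) (hs0 : s ≠ 0)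
    (hsu : ¬IsUnit s) (hres : ∀ x : N, ∃ c : k, x - ι c ∈ Ideal.span {s})
    [IsAdicComplete (Ideal.span {s}) N] :
    Nonempty (N ≃+* AdicCompletion (Ideal.span {(X : k[X])}) k[X]) :=
  ⟨(AdicCompletion.ofAlgEquiv (Ideal.span {s})).toRingEquiv.trans
    (adicCompletionEquivOfQuotientMap _ _ (eval₂RingHom ι s) (map_span_X_le ι s)
      (quotientMap_eval₂RingHom_bijective ι s hs0 hsu hres)).symm⟩

end PolynomialModel

/-! ## Normalisations of domains finite over a complete local ring with coefficient field `k` -/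

section Normalisation

/-- **If a domain `B` is integral over `A` and `A → B` kills an ideal `I` with `A = ι(k) + I`
(`k` algebraically closed), then the normalisation of `B` is `≅ k`**: the composite
`k → A → B → B̄` is integral into a domain, hence bijective. [folklore] -/
theorem nonempty_integralClosure_equiv_of_le_ker {k : Type u} [Field k] [IsAlgClosed k]
    {A : Type v} [CommRing A] (ι : k →+* A) (I : Ideal A) (hI : ∀ a : A, ∃ c : k, a - ι c ∈ I)
    (B : Type w) [CommRing B] [IsDomain B] [Algebra A B] [Algebra.IsIntegral A B]
    (hIB : I ≤ RingHom.ker (algebraMap A B)) :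
    Nonempty (integralClosure B (FractionRing B) ≃+* k) := by
  let g : A →+* integralClosure B (FractionRing B) :=
    (algebraMap B (integralClosure B (FractionRing B))).comp (algebraMap A B)
  have hg : g.IsIntegral :=
    RingHom.IsIntegral.trans _ _ (fun x => Algebra.IsIntegral.isIntegral x)
      (fun x => Algebra.IsIntegral.isIntegral x)
  have hIg : I ≤ RingHom.ker g := fun a ha => by
    rw [RingHom.mem_ker, RingHom.comp_apply, RingHom.mem_ker.mp (hIB ha), map_zero]
  exact ⟨(RingEquiv.ofBijective (g.comp ι)
    (comp_bijective_of_forall_sub_mem ι I hI g hg hIg)).symm⟩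

/-- **The normalisation of a domain finite over a complete one-dimensional local domain with
algebraically closed coefficient field.** Let `A` be a complete Noetherian local domain of
dimension `1` with `A = ι(k) + 𝔪_A`, `k` algebraically closed, and `B` a domain module-finite
over `A` with `A ↪ B`. Then the normalisation `N` of `B` — a complete discrete valuation ring
(K–V II (3.17), tree `isDiscreteValuationRing_integralClosure_of_complete`) — has a uniformiser
`s` (`s ≠ 0` a non-unit) with `N = ι(k) + sN` (its residue field is integral over `k`, hence
`= k`) and is `(s)`-adically complete. [folklore] -/
theorem exists_uniformizer_integralClosure {k : Type u} [Field k] [IsAlgClosed k] {A : Type u}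
    [CommRing A] [IsDomain A] [IsLocalRing A] [IsNoetherianRing A]
    [IsAdicComplete (maximalIdeal A) A] (hdimA : ringKrullDim A = 1) (ι : k →+* A)
    (hI : ∀ a : A, ∃ c : k, a - ι c ∈ maximalIdeal A) (B : Type u) [CommRing B] [IsDomain B]
    [Algebra A B] [Module.Finite A B] (hinj : Function.Injective (algebraMap A B)) :
    ∃ s : integralClosure B (FractionRing B), s ≠ 0 ∧ ¬IsUnit s ∧
      (∀ x : integralClosure B (FractionRing B), ∃ c : k,
        x - algebraMap B _ (algebraMap A B (ι c)) ∈ Ideal.span {s}) ∧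
      IsAdicComplete (Ideal.span {s}) (integralClosure B (FractionRing B)) := by
  -- `B` is a complete Noetherian local domain of dimension `1`
  haveI : IsNoetherianRing B :=
    isNoetherian_of_tower A (isNoetherian_of_isNoetherianRing_of_finite A B)
  haveI : IsLocalRing B := isLocalRing_of_isDomain_of_finite_of_isAdicComplete A B
  haveI : IsAdicComplete (maximalIdeal B) B :=
    Summit.Langlands.Langlands.Theorems.isAdicComplete_maximalIdeal_of_finite A B
  have hdimB : ringKrullDim B = 1 := by
    rw [← Literature.RingTheory.KrullDimension.ringKrullDim_eq_of_isIntegral hinj, hdimA]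
  -- its normalisation `N` is a finite complete discrete valuation ring
  haveI : Module.Finite B (integralClosure B (FractionRing B)) :=
    module_finite_integralClosure_of_complete B hdimB
  haveI : IsDiscreteValuationRing (integralClosure B (FractionRing B)) :=
    isDiscreteValuationRing_integralClosure_of_complete B hdimB
  haveI : IsAdicComplete (maximalIdeal (integralClosure B (FractionRing B)))
      (integralClosure B (FractionRing B)) :=
    Summit.Langlands.Langlands.Theorems.isAdicComplete_maximalIdeal_of_finite B _
  obtain ⟨s, hs⟩ := IsDiscreteValuationRing.exists_irreducible (integralClosure B (FractionRing B))
  have hms : maximalIdeal (integralClosure B (FractionRing B)) = Ideal.span {s} :=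
    hs.maximalIdeal_eq
  -- the residue field of `N` is `k`
  let φ : A →+* integralClosure B (FractionRing B) :=
    (algebraMap B (integralClosure B (FractionRing B))).comp (algebraMap A B)
  have hφ : φ.IsIntegral :=
    RingHom.IsIntegral.trans _ _ (fun x => Algebra.IsIntegral.isIntegral x)
      (fun x => Algebra.IsIntegral.isIntegral x)
  have hcomap : (maximalIdeal (integralClosure B (FractionRing B))).comap φ = maximalIdeal A :=
    IsLocalRing.eq_maximalIdeal (Ideal.isMaximal_comap_of_isIntegral_of_isMaximal' φ hφ _)
  let g : A →+* ResidueField (integralClosure B (FractionRing B)) :=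
    (residue (integralClosure B (FractionRing B))).comp φ
  have hg : g.IsIntegral :=
    RingHom.IsIntegral.trans _ _ hφ (RingHom.isIntegral_of_surjective _ residue_surjective)
  have hIg : maximalIdeal A ≤ RingHom.ker g := fun a ha => by
    rw [RingHom.mem_ker, RingHom.comp_apply, residue_eq_zero_iff, ← Ideal.mem_comap, hcomap]
    exact ha
  have hbij := comp_bijective_of_forall_sub_mem ι _ hI g hg hIg
  refine ⟨s, hs.ne_zero, hs.not_isUnit, fun x => ?_, by rw [← hms]; infer_instance⟩
  obtain ⟨c, hc⟩ := hbij.2 (residue _ x)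
  refine ⟨c, ?_⟩
  rw [← hms, ← residue_eq_zero_iff, map_sub, sub_eq_zero, ← hc]
  rfl

end Normalisation

/-! ## Power series rings: `k⟦X_σ⟧ = k + 𝔪` -/

section PowerSeries

/-- Every power series over a field is congruent to its constant term modulo the maximal ideal.
[folklore] -/
theorem exists_sub_C_mem_maximalIdeal (σ : Type v) (k : Type u) [Field k] (a : MvPowerSeries σ k) :
    ∃ c : k, a - MvPowerSeries.C c ∈ maximalIdeal (MvPowerSeries σ k) :=
  ⟨MvPowerSeries.constantCoeff a, by
    rw [mem_maximalIdeal, mem_nonunits_iff, MvPowerSeries.isUnit_iff_constantCoeff, map_sub,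
      MvPowerSeries.constantCoeff_C, sub_self]
    exact not_isUnit_zero⟩

end PowerSeries

end Summit.ResolutionOfSingularities.ResolutionOfSingularities.Theorems.TeissierResolve.ToricNormalisationDimLeOneLemmas

end
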